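import Literature.AlgebraicGeometry.Frobenioids.PadicFrobenioidSplitting
import Literature.AlgebraicGeometry.Frobenioids.ModelFrobenioidNormalized
import Literature.AlgebraicGeometry.Frobenioids.BaseFrobeniusSections
import HarnessLib

/-!
# Frobenioids II, Remark 1.2.1: the Frobenius functors of an absolutely primitive `p`-adic Frobenioid

Mochizuki, *The geometry of Frobenioids II*, Kyushu J. Math. **62** (2008) 401–460, §1, Remark 1.2.1, p. 10
[cite: MochizukiFrdII2008, Rmk 1.2.1 p.10]:

> "We observe in passing that if `Φ` is absolutely primitive, then by Theorem 1.2, (i), (v), it follows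
> that `C` admits unit-linear Frobenius functors as in [FrdI], Proposition 2.5, (iii) [where one takes the
> 'Λ' of loc. cit. to be `ℤ`], and unit-wise Frobenius functors as in [FrdI], Corollary 2.6. If, moreover,
> `Λ = ℤ`, then `C` admits unit-wise Frobenius functors as in [FrdI], Proposition 2.9, (ii)."

This file BINDS the three Frobenius-functor slots of the vocabulary record `Thm12Vocab` of
`PadicFrobenioidThm12.lean` (abc-iut-L1-t4; RQ7 note N1 "schema until TODO-merge") to the tree's typing of
[FrdI] Prop. 2.5 (iii), Cor. 2.6 (abc-iut-L1-t2, `CharacteristicSplitting.lean`) and Prop. 2.9 (ii)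
(`BaseFrobeniusSections.lean`): "`C` admits … Frobenius functors as in loc. cit." = the CONCLUSION of the
cited statement holds for `C` (for every `d ∈ ℕ_{≥1}`, resp. every `ζ : Primes → ℕ_{≥1}`), verbatim as
typed there with `C := d.frobenioid`, `C → F_Φ := d.structureFunctor`:

* `Thm12Vocab.bindFrobenius V` — the record with the characteristic-splitting slot bound as in
  `PadicFrobenioidSplitting.lean` and the three Frobenius-functor slots bound as just said (the model-type and
  rationally-standard slots stay those of `V`: their owners' constructions are pending);
* `Datum.rmk121_bindFrobenius` — **Remark 1.2.1 for the bound vocabulary**, derived exactly as in print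
  "by Theorem 1.2, (i), (v)" from the cited [FrdI] statements taken as named facts (`UnitLinearFrobeniusExists`,
  `UnitWiseFrobeniusExists`, `UnitWiseFrobeniusZetaExists` — their proofs are other seats' items) by verifying
  their antecedents for the `p`-adic Frobenioid: the characteristic splitting `τ_p` (Thm. 1.2 (v),
  `Datum.pSplitting`), Frobenius-normalized type (abc-iut-L1-d8's `ModelFrobenioid.isOfType_isFrobeniusNormalized`),
  base-trivial hence metrically trivial type (Thm. 1.2 (v), abc-iut-L1-d10), `Aut`-ample type (Thm. 1.2 (i),
  abc-iut-L1-d10); the inputs not yet discharged in the tree — "`C` is a Frobenioid" and "of isotropic type"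
  ([FrdI] Thm. 5.2 (ii), abc-iut-found), "of pre-model type" ([FrdI] Def. 2.7 (iii)), "of unit-profinite type"
  (Thm. 1.2 (i), `Thm12_i_unitProfinite`, abc-iut-L1-d10) — are explicit hypotheses;
* `Datum.thm12_v_bindFrobenius` — Theorem 1.2 (v) for the same bound vocabulary.

Nothing here is asserted beyond what is proved; no statement of the paper is strengthened.
-/

noncomputable section

namespace Literature.AlgebraicGeometry.Frobenioids

namespace PadicFrd

open CategoryTheory Opposite Function PreFrobenioid

universe v u

variable {D : Type u} [Category.{v} D] {p : ℕ} [Fact p.Prime] {d : Datum D p}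

/-- The vocabulary record `V` with FOUR slots bound to the tree: the characteristic-splitting slot ([FrdI]
Def. 2.3, abc-iut-L1-t2's `CharacteristicSplitting`, as in `Thm12Vocab.bindSplitting`) and the three
Frobenius-functor slots of Remark 1.2.1 — "`C` admits unit-linear Frobenius functors as in [FrdI]
Prop. 2.5 (iii) [with `Λ = ℤ`]" = for every `d ∈ ℕ_{≥1}` the conclusion of t2's `UnitLinearFrobeniusExists`
(an equivalence `Ψ : C ⥲ C(d)`, identity on objects and isometries, `1`-compatible with the Frobenius functor
on `F_Φ`); "unit-wise Frobenius functors as in [FrdI] Cor. 2.6" = for every `d` the conclusion (a)–(d) of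
`UnitWiseFrobeniusExists`; "unit-wise Frobenius functors as in [FrdI] Prop. 2.9 (ii)" = for every `ζ` the
conclusion (a)–(d) of `UnitWiseFrobeniusZetaExists` (whose clause (c) is phrased over the commutative group
`O^×(A)`, hence under "`C` is a Frobenioid"). The model-type / rationally-standard slots are those of `V`.
[cite: MochizukiFrdII2008, Rmk 1.2.1 p.10] -/
def Thm12Vocab.bindFrobenius (V : Thm12Vocab d) : Thm12Vocab d where
  IsOfModelType := V.IsOfModelType
  IsOfRationallyStandardType := V.IsOfRationallyStandardType
  IsCharacteristicSplitting τ := ∃ T : CharacteristicSplitting d.structureFunctor, T.τ = τ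
  AdmitsUnitLinearFrobeniusFunctors := ∀ n : ℕ+,
    ∃ U : UnitLinearFrobeniusData d.structureFunctor (powEnd d.Φ n), U.functor.IsEquivalence ∧
      OneCommutes U.functor (wideSubcategoryInclusion (divIn d.structureFunctor (powEnd d.Φ n)) ⋙ d.structureFunctor)
        d.structureFunctor (ElemFrobenioid.frobenius d.Φ n)
  AdmitsUnitwiseFrobeniusFunctorsI := ∀ n : ℕ+,
    ∃ Ψ : d.frobenioid ⥤ d.frobenioid,
      OneCommutes Ψ d.structureFunctor d.structureFunctor (𝟭 (ElemFrobenioid d.Φ)) ∧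
      (∀ A : d.frobenioid, IsIsotropic d.structureFunctor A → Nonempty (Ψ.obj A ≅ A)) ∧
      (∀ {A B : d.frobenioid} (φ : A ⟶ B), IsIsotropic d.structureFunctor A → IsIsotropic d.structureFunctor B →
        (IsFrobeniusType d.structureFunctor φ ∨ IsPreStep d.structureFunctor φ ∨
          IsPullbackMorphism d.structureFunctor φ) →
          IsAbstractlyEquivalent (Ψ.map φ) φ) ∧
      (∀ A : d.frobenioid, IsIsotropic d.structureFunctor A → ∃ e : Ψ.obj A ≅ A,
        ∀ u ∈ unitsSubgroup d.structureFunctor A, e.inv ≫ Ψ.map u.hom ≫ e.hom = (u ^ (n : ℕ)).hom) ∧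
      (IsOfPerfectType d.structureFunctor → Ψ.IsEquivalence) ∧
      ((n = 1 ∨ (IsOfIsotropicType d.structureFunctor ∧ IsOfType (IsUnitTrivial d.structureFunctor))) →
        Nonempty (Ψ ≅ 𝟭 d.frobenioid))
  AdmitsUnitwiseFrobeniusFunctorsII := ∀ (ζ : Nat.Primes → ℕ+) (hF : IsFrobenioid d.structureFunctor),
    ∃ Ψ : d.frobenioid ⥤ d.frobenioid,
      OneCommutes Ψ d.structureFunctor d.structureFunctor (𝟭 (ElemFrobenioid d.Φ)) ∧
      (∀ A : d.frobenioid, Nonempty (Ψ.obj A ≅ A)) ∧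
      (∀ {A B : d.frobenioid} (φ : A ⟶ B),
        (IsFrobeniusType d.structureFunctor φ ∨ IsPreStep d.structureFunctor φ ∨
          IsPullbackMorphism d.structureFunctor φ) →
          IsAbstractlyEquivalent (Ψ.map φ) φ) ∧
      (∀ A : d.frobenioid, ∃ (e : Ψ.obj A ≅ A) (t : TopologicalSpace (unitsSubgroup d.structureFunctor A))
        (f : unitsSubgroup d.structureFunctor A → unitsSubgroup d.structureFunctor A),
          @IsTfgProfinite _ _ t ∧ @IsZetaPowerMap _ (unitsCommGroup d.structureFunctor hF A) t ζ f ∧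
            ∀ u : unitsSubgroup d.structureFunctor A, e.inv ≫ Ψ.map u.1.hom ≫ e.hom = (f u).1.hom) ∧
      (IsOfCoprimeType ζ → Ψ.IsEquivalence) ∧
      (IsOfType (IsUnitTrivial d.structureFunctor) → Nonempty (Ψ ≅ 𝟭 d.frobenioid))

/-- The Frobenius-bound vocabulary has the same characteristic-splitting slot as `bindSplitting`.
[cite: MochizukiFrdII2008, Thm 1.2 (v) p.9] -/
theorem Thm12Vocab.bindFrobenius_isCharacteristicSplitting (V : Thm12Vocab d)
    (τ : ∀ A : d.frobenioid, Submonoid (End A)) :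
    (V.bindFrobenius).IsCharacteristicSplitting τ ↔ ∃ T : CharacteristicSplitting d.structureFunctor, T.τ = τ :=
  Iff.rfl

namespace Datum

variable (d)

/-- **Theorem 1.2 (v)** for the Frobenius-bound vocabulary (same proof as `thm12_v_bindSplitting`: base-trivial
type, abc-iut-L1-d10, and the characteristic splitting `τ_p`). [cite: MochizukiFrdII2008, Thm 1.2 (v) p.9] -/
theorem thm12_v_bindFrobenius (V : Thm12Vocab d) : Thm12_v d V.bindFrobenius :=
  d.thm12_v_of V.bindFrobenius fun hap =>
    ⟨d.pSplittingSubmonoid, ⟨d.pSplitting hap, rfl⟩, fun X _ hf => (d.pSplittingSubmonoid_le X) hf⟩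

/-- For absolutely primitive `Φ` the `p`-adic Frobenioid is of metrically trivial type (it is of base-trivial
type, Thm. 1.2 (v) — abc-iut-L1-d10 — and base-trivial objects are metrically trivial, [FrdI] Rmk. 1.2.1).
[cite: MochizukiFrdII2008, Thm 1.2 (v) p.9] -/
theorem isOfType_isMetricallyTrivial_of_isAbsolutelyPrimitive (hap : d.IsAbsolutelyPrimitive) :
    IsOfType (IsMetricallyTrivial d.structureFunctor) :=
  fun A => (d.thm12_isBaseTrivial_of_isAbsolutelyPrimitive hap A).isMetricallyTrivial

/-- **Remark 1.2.1** (FrdII p. 10) for the vocabulary bound to the tree: if `Φ` is absolutely primitive then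
`C` admits unit-linear Frobenius functors as in [FrdI] Prop. 2.5 (iii), unit-wise Frobenius functors as in
[FrdI] Cor. 2.6 and (here `Λ = ℤ`) unit-wise Frobenius functors as in [FrdI] Prop. 2.9 (ii) — derived, as in
print, "by Theorem 1.2, (i), (v)": the antecedents of the three cited statements are the characteristic
splitting `τ_p` (`pSplitting`), Frobenius-normalized type (every model Frobenioid, abc-iut-L1-d8),
metrically trivial type (base-trivial, Thm. 1.2 (v)) and `Aut`-ample type (Thm. 1.2 (i)), plus — for
Prop. 2.9 (ii) — base-trivial, isotropic, pre-model and unit-profinite type. CONDITIONAL on the cited [FrdI]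
statements as named facts (`h25`, `h26`, `h29`: Prop. 2.5 (iii), Cor. 2.6, Prop. 2.9 (ii) as typed by
abc-iut-L1-t2) and on the hypotheses "`C` is a Frobenioid" (`hF`), "of isotropic type" (`hiso`; both [FrdI]
Thm. 5.2 (ii)), "of pre-model type" (`hpre`, [FrdI] Def. 2.7 (iii)) and "of unit-profinite type" (`hup`,
Thm. 1.2 (i) first sentence, `Thm12_i_unitProfinite`). [cite: MochizukiFrdII2008, Rmk 1.2.1 p.10] -/
theorem rmk121_bindFrobenius (V : Thm12Vocab d) (hF : IsFrobenioid d.structureFunctor)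
    (h25 : ∀ n : ℕ+, UnitLinearFrobeniusExists d.structureFunctor n)
    (h26 : ∀ n : ℕ+, UnitWiseFrobeniusExists d.structureFunctor n)
    (h29 : ∀ ζ : Nat.Primes → ℕ+, UnitWiseFrobeniusZetaExists d.structureFunctor ζ)
    (hiso : IsOfIsotropicType d.structureFunctor) (hpre : IsOfPreModelType d.structureFunctor)
    (hup : Thm12_i_unitProfinite d) : Rmk121 d V.bindFrobenius := fun hap =>
  ⟨fun n => h25 n (d.pSplitting hap) hF ModelFrobenioid.isOfType_isFrobeniusNormalized
      (d.isOfType_isMetricallyTrivial_of_isAbsolutelyPrimitive hap) d.thm12_isAutAmple,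
    fun n => h26 n (d.pSplitting hap) hF ModelFrobenioid.isOfType_isFrobeniusNormalized
      (d.isOfType_isMetricallyTrivial_of_isAbsolutelyPrimitive hap) d.thm12_isAutAmple,
    fun ζ hF' => h29 ζ (d.pSplitting hap) hF' ModelFrobenioid.isOfType_isFrobeniusNormalized
      (d.thm12_isBaseTrivial_of_isAbsolutelyPrimitive hap) hiso d.thm12_isAutAmple hpre hup⟩

/-- **Remark 1.2.1, first two clauses, with fewer hypotheses**: the unit-linear (Prop. 2.5 (iii)) and
unit-wise (Cor. 2.6) Frobenius functors exist for the `p`-adic Frobenioid with absolutely primitive `Φ` as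
soon as `C` is a Frobenioid and the two cited [FrdI] statements hold. [cite: MochizukiFrdII2008, Rmk 1.2.1 p.10] -/
theorem rmk121_unitLinear_unitWise (V : Thm12Vocab d) (hF : IsFrobenioid d.structureFunctor)
    (h25 : ∀ n : ℕ+, UnitLinearFrobeniusExists d.structureFunctor n)
    (h26 : ∀ n : ℕ+, UnitWiseFrobeniusExists d.structureFunctor n) (hap : d.IsAbsolutelyPrimitive) :
    (V.bindFrobenius).AdmitsUnitLinearFrobeniusFunctors ∧ (V.bindFrobenius).AdmitsUnitwiseFrobeniusFunctorsI :=
  ⟨fun n => h25 n (d.pSplitting hap) hF ModelFrobenioid.isOfType_isFrobeniusNormalized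
      (d.isOfType_isMetricallyTrivial_of_isAbsolutelyPrimitive hap) d.thm12_isAutAmple,
    fun n => h26 n (d.pSplitting hap) hF ModelFrobenioid.isOfType_isFrobeniusNormalized
      (d.isOfType_isMetricallyTrivial_of_isAbsolutelyPrimitive hap) d.thm12_isAutAmple⟩

end Datum

end PadicFrd

end Literature.AlgebraicGeometry.Frobenioids
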